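import Summits.QuantumFields.BalabanUV.Beta.GAN24.DerivativeRateTransferLoewner
import Summits.QuantumFields.BalabanUV.Beta.GAN24.GalerkinPythagoras

/-!
# `BalabanUV.Beta.GAN24.DerivativeRateTransferLoewnerLegs` — binder row G-an2-4 ∕ (CONV-C), route R6 «VALUES, NOT DERIVATIVES», PART 17:
# THE MINIMISER LEGS IN ENERGY CURRENCY FOLLOW FROM THE SAME DATUM — the one-step defect of the unit-source minimiser leg against its
# prolongated predecessor, measured in the fine energy norm, EQUALS (CONS) minus the effective-form step, hence is `≤ (CONS)`:
# `re ⟨P_kℋ_k e_y − ℋ_{k+1}e_y, H_{k+1}(P_kℋ_k e_y − ℋ_{k+1}e_y)⟩ = (CONS_{k,y}) − (re Δ_eff^{(k+1)}_{yy} − re Δ_eff^{(k)}_{yy}) ≤ cst·θ^k`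
# (unit b2b-balaban-gan24-p3, gen 36; v1)

NOT IN PRINT; OUR PROOF (for the ROUTE; [folklore] — this lineage's `GalerkinPythagoras.hard_pythagoras` (gen 25, R7 (ρ3)) + p3's
`PropagatorWoodburyFibre` KKT identities + PART 15 + road P4's `effForm_chain_step_of_stab` BY NAME).  HONEST FRAMING (cell contract, verbatim):
«discharging `BetaPertH` makes Bałaban's UV stability UNCONDITIONAL — a real constructive-QFT result; it is NOT the continuum limit and NOT the Clay
problem.»  HONEST DEPENDENCY (verbatim): «continuum YM on T⁴ ⇐ BetaPertH ∧ nine spine estimates (0/9 proved); BetaPertH ⇐ (D1) ∧ (D4) ∧ CAP+tail;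
G-an2-4 gates asym, D1 and NE2/3/4.»

WHY THIS FILE.  PARTs 15–16 serve the two SYMMETRIC unit-level blocks (effective forms, next-constraint covariances) and display honestly that
the minimiser LEGS `ℋ_k e_y` (non-symmetric, fine-indexed) are NOT served in ENTRY currency (lens 1's (c1); gan24-idea-1 g34 W-idea1-g34-2 books the
residual as «S1-legs [open, no positivity]»).  Route R7 (ρ3) consumes legs in ENERGY currency («‖∇_η(𝓗_{k+1}e_y − ι𝓗_ke_y)‖ ≤ C_H θ₁^k»), and
this lineage's `GalerkinPythagoras` (gen 25) proved the exact identity behind it: for the constrained quadratic minimum, `⟨f − u, K(f − u)⟩ =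
⟨f,Kf⟩ − ⟨u,Ku⟩` for every admissible trial `f`.  THIS FILE reads that identity at the trial `f = P_kℋ_k e_y` of PART 15: the leg defect in the
`H_{k+1}`-energy norm IS «(CONS) minus the effective-form step», so (STAB) + (CONS) bound it by the SAME `cst·θ^k` — ONE scalar datum per `(k, y)`
drives all three letters (effective form, covariance, leg-in-energy).  What stays open for legs is only the passage from the energy norm of the
defect to whatever currency a consumer wants (R7's (ρ3) wants exactly the energy norm; sup ∕ entry readings of fine legs are V40 ∕ (H2) territory).

WHAT THIS FILE PROVES (0 sorry, 0 `def`, nothing cited):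
* §1 `form_mulVec_minimiser_single` (KKT: `H(ℋe_y) = Qᴴ(Δ_eff e_y)`), **`leg_energy_defect_eq`** (`re ⟨Pℋe_y − ℋ′e_y, H′(Pℋe_y − ℋ′e_y)⟩ =
  re ⟨ℋe_y, (PᴴH′P − H)ℋe_y⟩ − (re Δ_eff(H′,Q′)_{yy} − re Δ_eff(H,Q)_{yy})` when `Q′P = Q`), **`leg_energy_defect_le_cons`** (`≤` the consistency
  defect as soon as `re Δ_eff(H,Q)_{yy} ≤ re Δ_eff(H′,Q′)_{yy}`, e.g. under (STAB)), `leg_energy_defect_nonneg`.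
* §2 THE TOWER END **`leg_energy_step_rate_of_stab_of_cons`** — PART 15's tower hypotheses ((STAB_j), (CONS_{j,y}), `Qc (j+1) = Qc j · Qf j`,
  `Qc (j+1) · P j = Qc j`) ⟹ `re ⟨P_jℋ_j e_y − ℋ_{j+1}e_y, H_{j+1}(P_jℋ_j e_y − ℋ_{j+1}e_y)⟩ ≤ cst·θ^j` for all `j, y`; and the EXACT bookkeeping
  `leg_energy_defect_add_step_eq_cons` ((leg defect) + (effective-form step) = (CONS), all three nonnegative under (STAB)).
WHAT IT DOES NOT DO: read the energy-norm defect in sup ∕ entry currency; discharge (STAB)∕(CONS); identify `ℋ_k` with Bałaban's `𝓗_k` (S2(ii)).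
SUPPLIER work on route R6 ∕ R7 (ρ3) (no seat); no consumer of record; NEVER «G-an2-4 closed»; NOT (CONV-C), NOT D1, NOT `BetaPertH`, NOT continuum,
NOT Clay.  Records: `HOME/b2b-balaban-gan24-p3/WOODBURY-FIBRE.md` v13.6, `gen36/R6-LOEWNER-NOTE.md`.
-/

noncomputable section

open Matrix

namespace Summit.QuantumFields.BalabanUV.Beta.GAN24.DerivativeRateTransferLoewnerLegs

open scoped ComplexOrder
open Summit.QuantumFields.BalabanUV.Beta.PropagatorWoodburyFibre
open Summit.QuantumFields.BalabanUV.Beta.GAN24.MonotoneCoarsen (effForm_chain_step_of_stab)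
open Summit.QuantumFields.BalabanUV.Beta.GAN24.GalerkinPythagoras (hard_pythagoras)
open Summit.QuantumFields.BalabanUV.Beta.GAN24.DerivativeRateTransferLoewner (star_single_dotProduct_mulVec_single energy_conj
  re_effForm_apply_eq_minimiser constraint_mulVec_minimiser_single re_effForm_step_diag_le_cons)

/-! ## §1 The leg defect in the fine energy norm is (CONS) minus the effective-form step -/

section Legs

variable {m n n' : Type*} [Fintype m] [Fintype n] [Fintype n'] [DecidableEq m] [DecidableEq n] [DecidableEq n']
variable {H : Matrix n n ℂ} {Q : Matrix m n ℂ} {H' : Matrix n' n' ℂ} {Q' : Matrix m n' ℂ} {P : Matrix n' n ℂ}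

/-- [folklore] KKT for the unit-source minimiser: `H(ℋe_y) = Qᴴ(Δ_eff e_y)` (`ℋ = H⁻¹QᴴΔ_eff`). -/
theorem form_mulVec_minimiser_single (hH : H.PosDef) (y : m) :
    H *ᵥ (minimiser H Q *ᵥ Pi.single y 1) = Qᴴ *ᵥ (effForm H Q *ᵥ Pi.single y 1) := by
  have hH' := (isUnit_iff_isUnit_det _).mp hH.isUnit
  rw [mulVec_mulVec, mulVec_mulVec, minimiser, ← Matrix.mul_assoc, ← Matrix.mul_assoc, mul_nonsing_inv _ hH', Matrix.one_mul]

/-- **THE LEG DEFECT IN ENERGY NORM = (CONS) − (EFFECTIVE-FORM STEP), EXACTLY** [our proof over `GalerkinPythagoras.hard_pythagoras`]: `0 < H`,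
`0 < H′`, `Q, Q′` with independent rows, `Q′P = Q`; `m := ℋe_y` (level `H`), `u := ℋ′e_y` (level `H′`), trial `f := Pm` (admissible: `Q′f = e_y = Q′u`):
`re ⟨f − u, H′(f − u)⟩ = re ⟨m, (PᴴH′P − H)m⟩ − (re Δ_eff(H′,Q′)_{yy} − re Δ_eff(H,Q)_{yy})`. -/
theorem leg_energy_defect_eq (hH : H.PosDef) (hQ : Function.Injective Q.vecMul) (hH' : H'.PosDef)
    (hQ' : Function.Injective Q'.vecMul) (hPQ : Q' * P = Q) (y : m) :
    (star (P *ᵥ (minimiser H Q *ᵥ Pi.single y 1) - minimiser H' Q' *ᵥ Pi.single y 1) ⬝ᵥ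
        (H' *ᵥ (P *ᵥ (minimiser H Q *ᵥ Pi.single y 1) - minimiser H' Q' *ᵥ Pi.single y 1))).re =
      (star (minimiser H Q *ᵥ Pi.single y 1) ⬝ᵥ
          ((Pᴴ * H' * P - H) *ᵥ (minimiser H Q *ᵥ Pi.single y 1))).re -
        ((effForm H' Q' y y).re - (effForm H Q y y).re) := by
  set my : n → ℂ := minimiser H Q *ᵥ Pi.single y 1 with hmy
  set u : n' → ℂ := minimiser H' Q' *ᵥ Pi.single y 1 with hu
  have hKKT : H' *ᵥ u = Q'ᴴ *ᵥ (effForm H' Q' *ᵥ Pi.single y 1) := form_mulVec_minimiser_single hH' y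
  have hadm : Q' *ᵥ (P *ᵥ my) = Q' *ᵥ u := by
    rw [mulVec_mulVec, hPQ, hmy, constraint_mulVec_minimiser_single hH hQ, hu, constraint_mulVec_minimiser_single hH' hQ']
  have hpy := hard_pythagoras hH'.isHermitian Q' hKKT hadm
  -- `⟨f, H′f⟩ = ⟨m, (PᴴH′P)m⟩`, `⟨u, H′u⟩ = Δ_eff(H′,Q′)_{yy}`, and `⟨m, Hm⟩ = Δ_eff(H,Q)_{yy}`
  have e1 : (star u ⬝ᵥ (H' *ᵥ u)).re = (effForm H' Q' y y).re := by rw [hu, ← re_effForm_apply_eq_minimiser hH' hQ' y]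
  have e2 : (star my ⬝ᵥ (H *ᵥ my)).re = (effForm H Q y y).re := by rw [hmy, ← re_effForm_apply_eq_minimiser hH hQ y]
  rw [hpy, Complex.sub_re, energy_conj, e1, Matrix.sub_mulVec, dotProduct_sub, Complex.sub_re, e2]
  ring

omit [DecidableEq n'] in
/-- the leg defect is nonnegative (`H′` positive definite). [folklore] -/
theorem leg_energy_defect_nonneg (hH' : H'.PosDef) (v : n' → ℂ) : 0 ≤ (star v ⬝ᵥ (H' *ᵥ v)).re :=
  (Complex.le_def.mp (hH'.posSemidef.dotProduct_mulVec_nonneg v)).1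

/-- **THE LEG DEFECT ≤ (CONS)** as soon as the effective form did not decrease at `y` (e.g. under (STAB)). [our proof] -/
theorem leg_energy_defect_le_cons (hH : H.PosDef) (hQ : Function.Injective Q.vecMul) (hH' : H'.PosDef)
    (hQ' : Function.Injective Q'.vecMul) (hPQ : Q' * P = Q) (y : m) (hmono : (effForm H Q y y).re ≤ (effForm H' Q' y y).re) :
    (star (P *ᵥ (minimiser H Q *ᵥ Pi.single y 1) - minimiser H' Q' *ᵥ Pi.single y 1) ⬝ᵥ
        (H' *ᵥ (P *ᵥ (minimiser H Q *ᵥ Pi.single y 1) - minimiser H' Q' *ᵥ Pi.single y 1))).re ≤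
      (star (minimiser H Q *ᵥ Pi.single y 1) ⬝ᵥ ((Pᴴ * H' * P - H) *ᵥ (minimiser H Q *ᵥ Pi.single y 1))).re := by
  rw [leg_energy_defect_eq hH hQ hH' hQ' hPQ y]
  linarith

/-- **THE EXACT BOOKKEEPING**: (leg defect) + (effective-form step at `y`) = (CONS_y) — one scalar datum per unit source splits into the two
nonnegative defects PART 15 and this file consume. [our proof] -/
theorem leg_energy_defect_add_step_eq_cons (hH : H.PosDef) (hQ : Function.Injective Q.vecMul) (hH' : H'.PosDef)
    (hQ' : Function.Injective Q'.vecMul) (hPQ : Q' * P = Q) (y : m) :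
    (star (P *ᵥ (minimiser H Q *ᵥ Pi.single y 1) - minimiser H' Q' *ᵥ Pi.single y 1) ⬝ᵥ
        (H' *ᵥ (P *ᵥ (minimiser H Q *ᵥ Pi.single y 1) - minimiser H' Q' *ᵥ Pi.single y 1))).re +
        ((effForm H' Q' y y).re - (effForm H Q y y).re) =
      (star (minimiser H Q *ᵥ Pi.single y 1) ⬝ᵥ ((Pᴴ * H' * P - H) *ᵥ (minimiser H Q *ᵥ Pi.single y 1))).re := by
  rw [leg_energy_defect_eq hH hQ hH' hQ' hPQ y]
  ring

end Legs

/-! ## §2 The tower END: (STAB) + (CONS) bound the leg defects with the same constant and exponent -/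

section Tower

variable {c : Type*} [Fintype c] [DecidableEq c]
variable {ι : ℕ → Type*} [∀ j, Fintype (ι j)] [∀ j, DecidableEq (ι j)]
variable {H : ∀ j, Matrix (ι j) (ι j) ℂ} {Qf : ∀ j, Matrix (ι j) (ι (j + 1)) ℂ} {Qc : ∀ j, Matrix c (ι j) ℂ}
variable {P : ∀ j, Matrix (ι (j + 1)) (ι j) ℂ} {cst θ : ℝ}

/-- **`leg_energy_step_rate_of_stab_of_cons` — THE LEGS IN ENERGY CURRENCY** [our proof]: under PART 15's tower hypotheses, for every level `j`
and unit source `y`, `re ⟨P_jℋ_j e_y − ℋ_{j+1}e_y, H_{j+1}(P_jℋ_j e_y − ℋ_{j+1}e_y)⟩ ≤ cst·θ^j` — the one-step defect of the minimiser leg against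
its prolongated predecessor, in the fine energy norm of the new level, is bounded by the SAME (CONS) datum that drives the effective-form rows. -/
theorem leg_energy_step_rate_of_stab_of_cons (hH : ∀ j, (H j).PosDef) (hQf : ∀ j, Function.Injective (Qf j).vecMul)
    (hQc : ∀ j, Function.Injective (Qc j).vecMul) (hcomp : ∀ j, Qc (j + 1) = Qc j * Qf j) (hPQ : ∀ j, Qc (j + 1) * P j = Qc j)
    (hstab : ∀ j, (H (j + 1) - (Qf j)ᴴ * H j * Qf j).PosSemidef)
    (hcons : ∀ j (y : c),
      (star (minimiser (H j) (Qc j) *ᵥ Pi.single y 1) ⬝ᵥ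
        (((P j)ᴴ * H (j + 1) * P j - H j) *ᵥ (minimiser (H j) (Qc j) *ᵥ Pi.single y 1))).re ≤ cst * θ ^ j) :
    ∀ j (y : c),
      (star (P j *ᵥ (minimiser (H j) (Qc j) *ᵥ Pi.single y 1) - minimiser (H (j + 1)) (Qc (j + 1)) *ᵥ Pi.single y 1) ⬝ᵥ
          (H (j + 1) *ᵥ (P j *ᵥ (minimiser (H j) (Qc j) *ᵥ Pi.single y 1) -
            minimiser (H (j + 1)) (Qc (j + 1)) *ᵥ Pi.single y 1))).re ≤ cst * θ ^ j := by
  intro j y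
  -- (STAB) ⟹ the composite effective forms increase, in particular at the diagonal entry `y`
  have hstep : (effForm (H (j + 1)) (Qc (j + 1)) - effForm (H j) (Qc j)).PosSemidef :=
    effForm_chain_step_of_stab (k₀ := 0) hH hQf hQc hcomp (fun j _ => hstab j) j (Nat.zero_le j)
  have hmono : (effForm (H j) (Qc j) y y).re ≤ (effForm (H (j + 1)) (Qc (j + 1)) y y).re := by
    have h := (Complex.le_def.mp (hstep.diag_nonneg (i := y))).1
    rw [Matrix.sub_apply, Complex.sub_re] at h
    simpa using h
  exact (leg_energy_defect_le_cons (hH j) (hQc j) (hH (j + 1)) (hQc (j + 1)) (hPQ j) y hmono).trans (hcons j y)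

end Tower

end Summit.QuantumFields.BalabanUV.Beta.GAN24.DerivativeRateTransferLoewnerLegs

end
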